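import Summits.QuantumFields.YangMills.Theses.CutoffNotchTransport
import Summits.QuantumFields.YangMills.Theorems.FirstExitWindowFirstExitWindowTailLFirstExitOne
import Literature.MathematicalPhysics.QuantumFieldTheory.Balaban1983to89.T3SmallLiftHistory
import Literature.MathematicalPhysics.QuantumFieldTheory.Balaban1983to89.T3Thresholds
import HarnessLib

/-!
# Route `CutoffNotchTransport` — the ZEROTH NOTCH WITH POLYNOMIAL SLACK: the capped exponential moment of a ONCE-AVERAGED plaquette
# is polynomially bounded in the bare inverse coupling (`--supports stmt-QuantumFields-26202 --as helper`; seat `ym-line-sfw-p1` g11)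

WHY.  The crux `NotchMomentRatioL` (stmt-QuantumFields-26202) at `j = 0` compares the capped moment of a once-averaged plaquette of run `K+1`
with the bare capped moment of run `K`, with a constant `A` UNIFORM in `K` and `γ`; its registered stub `stub_notchZero` inherits that
uniformity, which is equivalent to a volume-uniform equipartition bound and is NOT cheap (evidence `evid-26202-notchZero.md` on the item).
WHAT IS cheap, and proved here: ★★ `onceAveraged_cappedMoment_of_bareCappedMomentL` — given the landed base `BareCappedMomentL`
(stmt-QuantumFields-26203), for every `L`, `(b₀, p₀)` there are `γ₁ ∈ (0,1]`, `t₀ > 0`, `C ≥ 0`, `N` with, for every family with `F.L = L`,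
`0 < γ ≤ γ₁`, every `K`, `0 ≤ t ≤ t₀` and every level-1 plaquette `p` of run `K+1`:
`∫ exp(t·β_K·min(|Ū¹(∂p) − 1|², θ(K)²)) dGibbs_{K+1} ≤ C·β_K^N` — i.e. the zeroth notch with the RELAXED constant `A·β_K^N` that the
ideator's card mentions («glue-compatible relaxation A·β_h^{N_A}»).

THE ARGUMENT.  Box-locality of the (0.4) averaging (`FirstExitWindow.exists_blame_finset`, this seat's F1 file): with `W = L² + 6(5L)² + 1` and
the `≤ L² + 45L³` blamed bare plaquettes `q ∈ S(p)`, POINTWISE `min(|Ū¹(∂p)−1|², θ²) ≤ min(W²|U(∂q)−1|², θ²)` for SOME `q ∈ S(p)` (`pointwise_blame`: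
take `q` maximising `|U(∂q) − 1|` over `S(p)`; if `W|U(∂q)−1| ≥ θ` trivially, else the guard holds at `a = max` and the blame lemma gives
`|Ū¹(∂p)−1| ≤ (W−1)·max < W·max`), hence `exp(tβ_K·min(…)) ≤ 1 + Σ_{q∈S(p)} exp(tW²β_K·min(|U(∂q)−1|², (θ(K)/W)²))`; each summand is a bare
capped moment of run `K+1` at tilt `tW²/L` w.r.t. `β_{K+1} = Lβ_K` with cap `θ(K)/W ≤ θ(K+1)` (`T3SmallLiftHistory.mul_θBal_le_θBal_succ`, `√L ≤ W`),
so `≤ C_B·β_{K+1}^{N_B}` for `t ≤ t₀ := t₁L/W²`; `C = 1 + (L² + 45L³)·max C_B 0·L^{N_B}`, `N = N_B`.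

HONEST FRAMING.  A helper; it does NOT prove the registered stub (whose `A` is constant), nor the crux, nor any rung; R3 is a RECORD rung and the
YM mass gap is NOT proved.  No `def`, no `sorry`.

References: T. Bałaban, CMP **98** (1985) 17–51 [Balaban1985Averaging] (Prop. 1 (51) p.26, locality p.25); CMP **102** (1985) 255–275
[Balaban1985UV3] ((7) p.257, (71) p.273); [FrohlichIsraelLiebSimon1978] Thm 4.1.
-/

set_option autoImplicit false

noncomputable section

open MeasureTheory
open scoped BigOperators

namespace Summit.QuantumFields.YangMills.Theorems.CutoffNotchTransport

open Literature.MathematicalPhysics.QuantumFieldTheory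
open Literature.MathematicalPhysics.QuantumFieldTheory.Balaban1983to89
open Literature.MathematicalPhysics.QuantumFieldTheory.Balaban1983to89.T3ContinuumYM3Torus
open Literature.MathematicalPhysics.QuantumFieldTheory.Balaban1983to89.T3UnitScaleTilt
open Literature.MathematicalPhysics.QuantumFieldTheory.Balaban1983to89.T3UnitLawDensityEML (ℰp measurableE_ℰp)
open Literature.MathematicalPhysics.QuantumFieldTheory.Balaban1983to89.ExpMeanLog (expMeanLogSU deltaSU deltaSU_pos)
open Literature.MathematicalPhysics.QuantumFieldTheory.Balaban1983to89.BlockAveraging (blockAvg avgFun)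
open Literature.MathematicalPhysics.QuantumFieldTheory.Balaban1983to89.T3Thresholds (exists_gamma_forall_θBal_le)
open Literature.MathematicalPhysics.QuantumFieldTheory.Balaban1983to89.T3MinimiserStabilityReduction (θBal_pos)
open Literature.MathematicalPhysics.QuantumFieldTheory.Balaban1983to89.T3SmallLiftHistory (mul_θBal_le_θBal_succ)
open Literature.MathematicalPhysics.QuantumFieldTheory.Balaban1983to89.T4Continuum (measurable_iter)
open Summit.QuantumFields.YangMills.Theorems.FirstExitWindow (exists_blame_finset)

/-! ## §1 Pointwise: the capped deviation of `Ū¹(∂p)` is dominated by that of ONE blamed bare plaquette -/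

/-- **POINTWISE BLAME UNDER THE CAP**: let `S` blame `p` in the sense of `exists_blame_finset` with constant `W − 1` (`W ≥ 1`), and let
`0 ≤ θ` with `(((d+2)L)²/4)·(θ/W) < δ_N`.  Then for every configuration
`exp(s·min(|Ū(∂p)−1|², θ²)) ≤ 1 + Σ_{q∈S} exp(s·min(W²|U(∂q)−1|², θ²))` (`s ≥ 0`). [cite: Balaban1985Averaging, Prop. 1 (51) p.26 and p.25] -/
theorem exp_capped_le_one_add_sum {n : Type*} [Fintype n] [DecidableEq n] [Nonempty n] {P : Params} {j : ℕ}
    {S : Finset (Plaq P j)} {p : Plaq P (j + 1)} {W : ℝ} (hW : 1 ≤ W)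
    (hS : ∀ (U : GaugeField P j (Matrix.specialUnitaryGroup n ℂ)) (a : ℝ), 0 ≤ a →
      ((((P.d + 2) * P.L : ℕ) : ℝ) ^ 2 / 4) * a < deltaSU n →
      (∀ q ∈ S, dist1 (GaugeField.plaqHol U q) ≤ a) →
      dist1 (GaugeField.plaqHol (avgFun (expMeanLogSU (n := n)) U) p) ≤ (W - 1) * a)
    {θ : ℝ} (hθ : 0 ≤ θ) (hguard : ((((P.d + 2) * P.L : ℕ) : ℝ) ^ 2 / 4) * (θ / W) < deltaSU n) {s : ℝ} (hs : 0 ≤ s)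
    (U : GaugeField P j (Matrix.specialUnitaryGroup n ℂ)) :
    Real.exp (s * min (dist1 (GaugeField.plaqHol (avgFun (expMeanLogSU (n := n)) U) p) ^ 2) (θ ^ 2)) ≤
      1 + ∑ q ∈ S, Real.exp (s * min (W ^ 2 * dist1 (GaugeField.plaqHol U q) ^ 2) (θ ^ 2)) := by
  have hW0 : 0 < W := one_pos.trans_le hW
  have hsum0 : 0 ≤ ∑ q ∈ S, Real.exp (s * min (W ^ 2 * dist1 (GaugeField.plaqHol U q) ^ 2) (θ ^ 2)) :=
    Finset.sum_nonneg fun q _ => (Real.exp_pos _).le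
  set D := dist1 (GaugeField.plaqHol (avgFun (expMeanLogSU (n := n)) U) p) with hD
  have hD0 : 0 ≤ D := GaugeGroup.dist1_nonneg _
  by_cases hSe : S = ∅
  · -- no blamed plaquette: the blame lemma at `a = 0` forces `D = 0`
    have h0 := hS U 0 le_rfl (by rw [mul_zero]; exact deltaSU_pos) (fun q hq => by rw [hSe] at hq; simp at hq)
    have hD00 : D = 0 := le_antisymm (by rw [hD]; linarith) hD0
    have hmin : min (D ^ 2) (θ ^ 2) = 0 := by
      rw [hD00]; simp only [ne_eq, OfNat.ofNat_ne_zero, not_false_eq_true, zero_pow]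
      exact min_eq_left (sq_nonneg θ)
    rw [hmin, mul_zero, Real.exp_zero]
    linarith
  -- a maximiser of the bare deviations over `S`
  obtain ⟨q₀, hq₀, hmax⟩ := Finset.exists_max_image S (fun q => dist1 (GaugeField.plaqHol U q)) (Finset.nonempty_iff_ne_empty.mpr hSe)
  set m := dist1 (GaugeField.plaqHol U q₀) with hm
  have hm0 : 0 ≤ m := GaugeGroup.dist1_nonneg _
  -- the single term at `q₀` dominates
  have hterm : Real.exp (s * min (D ^ 2) (θ ^ 2)) ≤ Real.exp (s * min (W ^ 2 * m ^ 2) (θ ^ 2)) := by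
    refine Real.exp_le_exp.mpr (mul_le_mul_of_nonneg_left ?_ hs)
    by_cases hcase : θ ≤ W * m
    · -- the blamed plaquette is beyond the cap
      have h1 : θ ^ 2 ≤ W ^ 2 * m ^ 2 := by rw [← mul_pow]; exact pow_le_pow_left₀ hθ hcase 2
      rw [min_eq_right h1]
      exact min_le_right _ _
    · -- all blamed plaquettes are below `θ/W`: the guard holds at `a = m` and the blame lemma gives `D ≤ (W−1)m ≤ Wm`
      rw [not_le] at hcase
      have hmθ : m ≤ θ / W := by rw [le_div_iff₀ hW0]; linarith
      have hguard_m : ((((P.d + 2) * P.L : ℕ) : ℝ) ^ 2 / 4) * m < deltaSU n :=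
        lt_of_le_of_lt (mul_le_mul_of_nonneg_left hmθ (by positivity)) hguard
      have hblame := hS U m hm0 hguard_m (fun q hq => hmax q hq)
      have hDW : D ≤ W * m := hblame.trans (by nlinarith)
      have h1 : D ^ 2 ≤ W ^ 2 * m ^ 2 := by rw [← mul_pow]; exact pow_le_pow_left₀ hD0 hDW 2
      exact min_le_min_right _ h1
  have hle : Real.exp (s * min (W ^ 2 * m ^ 2) (θ ^ 2)) ≤
      ∑ q ∈ S, Real.exp (s * min (W ^ 2 * dist1 (GaugeField.plaqHol U q) ^ 2) (θ ^ 2)) :=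
    Finset.single_le_sum (f := fun q => Real.exp (s * min (W ^ 2 * dist1 (GaugeField.plaqHol U q) ^ 2) (θ ^ 2)))
      (fun q _ => (Real.exp_pos _).le) hq₀
  linarith

/-! ## §2 The once-averaged capped moment from the bare one -/

/-- ★★ **THE ZEROTH NOTCH WITH POLYNOMIAL SLACK** (module docstring): from `BareCappedMomentL`, for every `L`, `b₀ > 0`, `p₀ > 2` there are
`γ₁ ∈ (0,1]`, `t₀ > 0`, `C ≥ 0`, `N` such that for every family with `F.L = L`, every `0 < γ ≤ γ₁`, every `K`, every `0 ≤ t ≤ t₀` and every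
level-1 plaquette `p` of run `K+1`: `∫ exp(t·β_K·min(|Ū¹(∂p) − 1|², θ(K)²)) dGibbs_{K+1} ≤ C·β_K^N`, `β_K = (γL^{−K})⁻¹`.
[cite: Balaban1985Averaging, Prop. 1 (51) p.26; Balaban1985UV3, (71) p.273] -/
theorem onceAveraged_cappedMoment_of_bareCappedMomentL
    (hB : Summit.QuantumFields.YangMills.Theses.CutoffNotchTransport.BareCappedMomentL) :
    ∀ (L : ℕ) (b₀ p₀ : ℝ), 0 < b₀ → 2 < p₀ → ∃ (γ₁ t₀ C : ℝ) (N : ℕ), 0 < γ₁ ∧ γ₁ ≤ 1 ∧ 0 < t₀ ∧ 0 ≤ C ∧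
      ∀ (F : T3Family) (γ : ℝ), F.L = L → 0 < γ → γ ≤ γ₁ → ∀ (K : ℕ) (t : ℝ), 0 ≤ t → t ≤ t₀ →
        ∀ p : Plaq (F.P (K + 1)) 1,
          ∫ U, Real.exp (t * (γ * ((F.L : ℝ)⁻¹) ^ K)⁻¹ *
              min (dist1 (GaugeField.plaqHol
                (Averaging.iter (fun i => BlockAveraging.blockAvg (P := F.P (K + 1)) (j := i) ℰp) 1 U) p) ^ 2)
                (θBal F.L γ b₀ p₀ K ^ 2)) ∂(gibbsK F ℰp γ (K + 1)) ≤
            C * ((γ * ((F.L : ℝ)⁻¹) ^ K)⁻¹) ^ N := by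
  obtain ⟨t₁, CB, NB, ht₁, hBase⟩ := hB
  intro L b₀ p₀ hb₀ hp₀
  by_cases hL : 1 ≤ L
  swap
  · refine ⟨1, 1, 0, 0, one_pos, le_rfl, one_pos, le_rfl, ?_⟩
    intro F γ hFL
    exact absurd (hFL ▸ le_of_lt F.hL.2) hL
  -- constants
  set W : ℝ := (L : ℝ) ^ 2 + 6 * (((3 + 2) * L : ℕ) : ℝ) ^ 2 + 1 with hW
  have hL1 : (1 : ℝ) ≤ L := by exact_mod_cast hL
  have hL0 : (0 : ℝ) < L := by linarith
  have hW1 : 1 ≤ W := by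
    have : (0 : ℝ) ≤ (L : ℝ) ^ 2 + 6 * (((3 + 2) * L : ℕ) : ℝ) ^ 2 := by positivity
    linarith
  have hW0 : 0 < W := one_pos.trans_le hW1
  have hLW : (L : ℝ) ≤ W := by
    have h6 : (0 : ℝ) ≤ 6 * (((3 + 2) * L : ℕ) : ℝ) ^ 2 := by positivity
    nlinarith
  have h5 : (0 : ℝ) < (((3 + 2) * L : ℕ) : ℝ) := by exact_mod_cast (by omega : 0 < (3 + 2) * L)
  have hσ : 0 < deltaSU (Fin 2) / (((3 + 2) * L : ℕ) : ℝ) ^ 2 := div_pos deltaSU_pos (by positivity)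
  obtain ⟨γθ, hγθ, hγθ1, hθ⟩ := exists_gamma_forall_θBal_le hb₀ (by linarith : (0 : ℝ) < p₀) hσ
  set CB' : ℝ := max CB 0 with hCB'
  have hCB'0 : 0 ≤ CB' := le_max_right _ _
  refine ⟨γθ, t₁ * L / W ^ 2, 1 + ((L : ℝ) ^ 2 + 5 * ((L : ℝ) ^ 3 * (3 : ℝ) ^ 2)) * CB' * (L : ℝ) ^ NB, NB,
    hγθ, hγθ1, by positivity, by positivity, ?_⟩
  intro F γ hFL hγ hγ₁ K t ht htt p
  subst hFL
  have hγ1 : γ ≤ 1 := hγ₁.trans hγθ1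
  haveI := isProbabilityMeasure_gibbsK F ℰp hγ.le (K + 1)
  have hPd : (F.P (K + 1)).d = 3 := rfl
  have hPL : (F.P (K + 1)).L = F.L := rfl
  -- the two couplings and thresholds
  set βK : ℝ := (γ * ((F.L : ℝ)⁻¹) ^ K)⁻¹ with hβK
  set βK1 : ℝ := (γ * ((F.L : ℝ)⁻¹) ^ (K + 1))⁻¹ with hβK1
  have hx : 0 < γ * ((F.L : ℝ)⁻¹) ^ K := mul_pos hγ (pow_pos (inv_pos.mpr hL0) K)
  have hβK0 : 0 < βK := inv_pos.mpr hx
  have hβrel : βK1 = (F.L : ℝ) * βK := by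
    rw [hβK1, hβK, pow_succ, ← mul_assoc, mul_inv, inv_inv]; ring
  have hβK_one : 1 ≤ βK := by
    rw [hβK]
    refine (one_le_inv₀ hx).mpr ?_
    exact mul_le_one₀ hγ1 (pow_nonneg (inv_nonneg.mpr hL0.le) K)
      (pow_le_one₀ (inv_nonneg.mpr hL0.le) (inv_le_one_of_one_le₀ hL1))
  set θ : ℝ := θBal F.L γ b₀ p₀ K with hθdef
  have hθ0 : 0 ≤ θ := (θBal_pos hL hγ hγ1 hb₀ p₀ K).le
  have hθσ : θ ≤ deltaSU (Fin 2) / (((3 + 2) * F.L : ℕ) : ℝ) ^ 2 := hθ F.L hL γ hγ hγ₁ K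
  -- `θ(K)/W ≤ θ(K+1)` (`√L ≤ L ≤ W`)
  have hθsucc : θ / W ≤ θBal F.L γ b₀ p₀ (K + 1) := by
    have hκ : W⁻¹ * Real.sqrt (F.L : ℝ) ≤ 1 := by
      rw [inv_mul_le_iff₀ hW0, mul_one]
      calc Real.sqrt (F.L : ℝ) ≤ Real.sqrt ((F.L : ℝ) ^ 2) := Real.sqrt_le_sqrt (by nlinarith)
        _ = (F.L : ℝ) := Real.sqrt_sq hL0.le
        _ ≤ W := hLW
    have h := mul_θBal_le_θBal_succ hL hγ hγ1 hb₀.le (by linarith : (0 : ℝ) ≤ p₀) hκ K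
    rw [div_eq_inv_mul]; exact h
  -- the blamed bare plaquettes of `p` (run `K+1`, level 0)
  have hj : 0 + 1 ≤ (F.P (K + 1)).m + (F.P (K + 1)).K := by show 0 + 1 ≤ F.m + (K + 1); omega
  obtain ⟨S, hScard, hSdom⟩ := exists_blame_finset (n := Fin 2) hj p
  rw [hPd, hPL] at hScard hSdom
  push_cast at hScard
  have hSdom' : ∀ (U : GaugeField (F.P (K + 1)) 0 (Matrix.specialUnitaryGroup (Fin 2) ℂ)) (a : ℝ), 0 ≤ a →
      ((((F.P (K + 1)).d + 2) * (F.P (K + 1)).L : ℕ) : ℝ) ^ 2 / 4 * a < deltaSU (Fin 2) →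
      (∀ q ∈ S, dist1 (GaugeField.plaqHol U q) ≤ a) →
      dist1 (GaugeField.plaqHol (avgFun (expMeanLogSU (n := Fin 2)) U) p) ≤ (W - 1) * a := by
    intro U a ha hg hq
    have hg' : (((3 + 2) * F.L : ℕ) : ℝ) ^ 2 / 4 * a < deltaSU (Fin 2) := hg
    have := hSdom U a ha hg' hq
    have hWm1 : W - 1 = (F.L : ℝ) ^ 2 + 6 * (((3 + 2) * F.L : ℕ) : ℝ) ^ 2 := by rw [hW]; ring
    rw [hWm1]; exact this
  -- the guard at `θ/W`
  have hguard : ((((F.P (K + 1)).d + 2) * (F.P (K + 1)).L : ℕ) : ℝ) ^ 2 / 4 * (θ / W) < deltaSU (Fin 2) := by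
    show (((3 + 2) * F.L : ℕ) : ℝ) ^ 2 / 4 * (θ / W) < deltaSU (Fin 2)
    have hθW : θ / W ≤ θ := div_le_self hθ0 hW1
    calc (((3 + 2) * F.L : ℕ) : ℝ) ^ 2 / 4 * (θ / W)
        ≤ (((3 + 2) * F.L : ℕ) : ℝ) ^ 2 / 4 * (deltaSU (Fin 2) / (((3 + 2) * F.L : ℕ) : ℝ) ^ 2) :=
          mul_le_mul_of_nonneg_left (hθW.trans hθσ) (by positivity)
      _ = deltaSU (Fin 2) / 4 := by field_simp
      _ < deltaSU (Fin 2) := by linarith [deltaSU_pos (n := Fin 2)]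
  -- pointwise domination
  have hts : 0 ≤ t * βK := mul_nonneg ht hβK0.le
  have hpt : ∀ U : GaugeField (F.P (K + 1)) 0 (Matrix.specialUnitaryGroup (Fin 2) ℂ),
      Real.exp (t * βK * min (dist1 (GaugeField.plaqHol
          (Averaging.iter (fun i => BlockAveraging.blockAvg (P := F.P (K + 1)) (j := i) ℰp) 1 U) p) ^ 2) (θ ^ 2)) ≤
        1 + ∑ q ∈ S, Real.exp (t * βK * min (W ^ 2 * dist1 (GaugeField.plaqHol U q) ^ 2) (θ ^ 2)) :=
    fun U => exp_capped_le_one_add_sum (n := Fin 2) hW1 hSdom' hθ0 hguard hts U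
  -- each summand is a bare capped moment of run `K+1` at tilt `tW²/L ≤ t₁`, cap `θ/W ≤ θ(K+1)`
  have htilt : t * W ^ 2 / F.L ≤ t₁ := by
    rw [div_le_iff₀ hL0]
    have := mul_le_mul_of_nonneg_right htt (sq_nonneg W)
    calc t * W ^ 2 ≤ t₁ * ↑F.L / W ^ 2 * W ^ 2 := this
      _ = t₁ * F.L := by field_simp
  have htilt0 : 0 ≤ t * W ^ 2 / F.L := by positivity
  have hsummand : ∀ q ∈ S, ∫ U, Real.exp (t * βK * min (W ^ 2 * dist1 (GaugeField.plaqHol U q) ^ 2) (θ ^ 2))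
      ∂(gibbsK F ℰp γ (K + 1)) ≤ CB' * βK1 ^ NB := by
    intro q _
    have hbare := hBase F γ b₀ p₀ hγ hγ1 hb₀ (K + 1) (t * W ^ 2 / F.L) htilt0 htilt q
    refine le_trans ?_ (hbare.trans (mul_le_mul_of_nonneg_right (le_max_left _ _) (by positivity)))
    -- pointwise comparison of the integrands
    have hmeas_d : Measurable fun U : GaugeField (F.P (K + 1)) 0 (Matrix.specialUnitaryGroup (Fin 2) ℂ) =>
        dist1 (GaugeField.plaqHol U q) := RegularGaugeGroup.measurable_dist1.comp (Missing.measurable_plaqHol q)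
    have hint : Integrable (fun U : GaugeField (F.P (K + 1)) 0 (Matrix.specialUnitaryGroup (Fin 2) ℂ) =>
        Real.exp (t * W ^ 2 / F.L * (γ * ((F.L : ℝ)⁻¹) ^ (K + 1))⁻¹ *
          min (dist1 (GaugeField.plaqHol U q) ^ 2) (θBal F.L γ b₀ p₀ (K + 1) ^ 2))) (gibbsK F ℰp γ (K + 1)) := by
      have hm : Measurable fun U : GaugeField (F.P (K + 1)) 0 (Matrix.specialUnitaryGroup (Fin 2) ℂ) =>
          Real.exp (t * W ^ 2 / F.L * (γ * ((F.L : ℝ)⁻¹) ^ (K + 1))⁻¹ *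
            min (dist1 (GaugeField.plaqHol U q) ^ 2) (θBal F.L γ b₀ p₀ (K + 1) ^ 2)) :=
        Real.measurable_exp.comp (((hmeas_d.pow_const 2).min measurable_const).const_mul _)
      refine (integrable_const (Real.exp (t * W ^ 2 / F.L * (γ * ((F.L : ℝ)⁻¹) ^ (K + 1))⁻¹ *
        θBal F.L γ b₀ p₀ (K + 1) ^ 2))).mono' hm.aestronglyMeasurable (ae_of_all _ fun U => ?_)
      rw [Real.norm_eq_abs, abs_of_pos (Real.exp_pos _)]
      refine Real.exp_le_exp.mpr (mul_le_mul_of_nonneg_left (min_le_right _ _) ?_)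
      exact mul_nonneg htilt0 (by rw [← hβK1]; positivity)
    refine integral_mono_of_nonneg (ae_of_all _ fun U => (Real.exp_pos _).le) hint (ae_of_all _ fun U => ?_)
    refine Real.exp_le_exp.mpr ?_
    -- `tβ_K·min(W²d², θ²) = (tW²/L)·β_{K+1}·min(d², (θ/W)²) ≤ (tW²/L)·β_{K+1}·min(d², θ(K+1)²)`
    have hWd : W ^ 2 * dist1 (GaugeField.plaqHol U q) ^ 2 = W ^ 2 * (dist1 (GaugeField.plaqHol U q) ^ 2) := rfl
    have hθW2 : (θ / W) ^ 2 ≤ θBal F.L γ b₀ p₀ (K + 1) ^ 2 := pow_le_pow_left₀ (div_nonneg hθ0 hW0.le) hθsucc 2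
    have hmin : min (W ^ 2 * dist1 (GaugeField.plaqHol U q) ^ 2) (θ ^ 2) =
        W ^ 2 * min (dist1 (GaugeField.plaqHol U q) ^ 2) ((θ / W) ^ 2) := by
      rw [mul_min_of_nonneg _ _ (sq_nonneg W), div_pow, mul_div_cancel₀ _ (pow_ne_zero 2 hW0.ne')]
    rw [hmin, show (γ * ((F.L : ℝ)⁻¹) ^ (K + 1))⁻¹ = βK1 from rfl, hβrel]
    have hmin_le : min (dist1 (GaugeField.plaqHol U q) ^ 2) ((θ / W) ^ 2) ≤
        min (dist1 (GaugeField.plaqHol U q) ^ 2) (θBal F.L γ b₀ p₀ (K + 1) ^ 2) := min_le_min_left _ hθW2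
    have hmin0 : 0 ≤ min (dist1 (GaugeField.plaqHol U q) ^ 2) ((θ / W) ^ 2) := le_min (sq_nonneg _) (sq_nonneg _)
    calc t * βK * (W ^ 2 * min (dist1 (GaugeField.plaqHol U q) ^ 2) ((θ / W) ^ 2))
        = t * W ^ 2 / ↑F.L * (↑F.L * βK) * min (dist1 (GaugeField.plaqHol U q) ^ 2) ((θ / W) ^ 2) := by
          field_simp
      _ ≤ t * W ^ 2 / ↑F.L * (↑F.L * βK) * min (dist1 (GaugeField.plaqHol U q) ^ 2) (θBal F.L γ b₀ p₀ (K + 1) ^ 2) :=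
          mul_le_mul_of_nonneg_left hmin_le (by positivity)
  -- integrate the pointwise domination
  have hint_q : ∀ q ∈ S, Integrable (fun U : GaugeField (F.P (K + 1)) 0 (Matrix.specialUnitaryGroup (Fin 2) ℂ) =>
      Real.exp (t * βK * min (W ^ 2 * dist1 (GaugeField.plaqHol U q) ^ 2) (θ ^ 2))) (gibbsK F ℰp γ (K + 1)) := by
    intro q _
    have hmeas_d : Measurable fun U : GaugeField (F.P (K + 1)) 0 (Matrix.specialUnitaryGroup (Fin 2) ℂ) =>
        dist1 (GaugeField.plaqHol U q) := RegularGaugeGroup.measurable_dist1.comp (Missing.measurable_plaqHol q)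
    have hm : Measurable fun U : GaugeField (F.P (K + 1)) 0 (Matrix.specialUnitaryGroup (Fin 2) ℂ) =>
        Real.exp (t * βK * min (W ^ 2 * dist1 (GaugeField.plaqHol U q) ^ 2) (θ ^ 2)) :=
      Real.measurable_exp.comp ((((hmeas_d.pow_const 2).const_mul _).min measurable_const).const_mul _)
    refine (integrable_const (Real.exp (t * βK * θ ^ 2))).mono' hm.aestronglyMeasurable (ae_of_all _ fun U => ?_)
    rw [Real.norm_eq_abs, abs_of_pos (Real.exp_pos _)]
    exact Real.exp_le_exp.mpr (mul_le_mul_of_nonneg_left (min_le_right _ _) hts)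
  have hint_sum := integrable_finsetSum S hint_q
  have hint_rhs : Integrable (fun U : GaugeField (F.P (K + 1)) 0 (Matrix.specialUnitaryGroup (Fin 2) ℂ) =>
      1 + ∑ q ∈ S, Real.exp (t * βK * min (W ^ 2 * dist1 (GaugeField.plaqHol U q) ^ 2) (θ ^ 2))) (gibbsK F ℰp γ (K + 1)) :=
    (integrable_const _).add hint_sum
  have hX0 : 0 ≤ CB' * βK1 ^ NB := by positivity
  calc ∫ U, Real.exp (t * βK * min (dist1 (GaugeField.plaqHol
          (Averaging.iter (fun i => BlockAveraging.blockAvg (P := F.P (K + 1)) (j := i) ℰp) 1 U) p) ^ 2) (θ ^ 2))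
          ∂(gibbsK F ℰp γ (K + 1))
      ≤ ∫ U, (1 + ∑ q ∈ S, Real.exp (t * βK * min (W ^ 2 * dist1 (GaugeField.plaqHol U q) ^ 2) (θ ^ 2)))
          ∂(gibbsK F ℰp γ (K + 1)) :=
        integral_mono_of_nonneg (ae_of_all _ fun U => (Real.exp_pos _).le) hint_rhs (ae_of_all _ hpt)
    _ = 1 + ∑ q ∈ S, ∫ U, Real.exp (t * βK * min (W ^ 2 * dist1 (GaugeField.plaqHol U q) ^ 2) (θ ^ 2))
          ∂(gibbsK F ℰp γ (K + 1)) := by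
        rw [integral_add (integrable_const _) hint_sum, integral_const, integral_finsetSum S hint_q]
        simp
    _ ≤ 1 + ∑ _q ∈ S, CB' * βK1 ^ NB := by
        gcongr with q hq
        exact hsummand q hq
    _ = 1 + S.card * (CB' * βK1 ^ NB) := by rw [Finset.sum_const, nsmul_eq_mul]
    _ ≤ 1 + ((F.L : ℝ) ^ 2 + 5 * ((F.L : ℝ) ^ 3 * (3 : ℝ) ^ 2)) * (CB' * βK1 ^ NB) :=
        add_le_add le_rfl (mul_le_mul_of_nonneg_right hScard hX0)
    _ ≤ (1 + ((F.L : ℝ) ^ 2 + 5 * ((F.L : ℝ) ^ 3 * (3 : ℝ) ^ 2)) * CB' * (F.L : ℝ) ^ NB) * βK ^ NB := by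
        rw [hβrel, mul_pow]
        have h1 : (1 : ℝ) ≤ βK ^ NB := one_le_pow₀ hβK_one
        nlinarith [mul_nonneg (mul_nonneg (by positivity : (0 : ℝ) ≤ ((F.L : ℝ) ^ 2 + 5 * ((F.L : ℝ) ^ 3 * (3 : ℝ) ^ 2)) * CB')
          (pow_nonneg hL0.le NB)) (pow_nonneg hβK0.le NB)]

end Summit.QuantumFields.YangMills.Theorems.CutoffNotchTransport

end
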